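import Mathlib.LinearAlgebra.Pi
import Mathlib.LinearAlgebra.Quotient.Basic
import Mathlib.Tactic.Abel
import HarnessLib

/-!
# Double complexes with exact rows: the augmentation computes the total cohomology

C. A. Weibel, *An Introduction to Homological Algebra* (1994), §1.2.4–1.2.6 (double complexes with
ANTIcommuting squares `d^v d^h + d^h d^v = 0`, total complex `Tot`, `d = d^h + d^v`) and the
**Acyclic Assembly Lemma 2.7.3** (p. 59 of the held copy): a first-quadrant double complex with
exact columns (or exact rows) has acyclic total complex; as in the proof of Weibel's Thm. 2.7.2,
applied to the double complex obtained by adjoining an augmentation column, this says that **for a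
row-exact augmented first-quadrant double complex the augmentation `A → Tot K` is a
quasi-isomorphism**. This is the algebraic heart of the Čech–de Rham comparison (R. Bott, L. W. Tu,
*Differential Forms in Algebraic Topology* (1982), §8, "the generalized Mayer–Vietoris principle",
and §12) and of Leray's theorem on acyclic covers; G. E. Bredon, *Sheaf Theory* (1997), Appendix A
§2 (pp. 487–488 of the held copy) uses the same sign conventions and edge homomorphism
`"H⁰(C^{*,*}) ↣ C^*`.

Everything here is elementary and CONCRETE (modules over a commutative ring `R`, `ℕ × ℕ`-indexed
families, no category theory), so that it can be instantiated both by the chart-wise de Rham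
complexes of `Literature.Geometry.Kaehler.LocalForms` and by the singular cochains of open subsets of
`Literature.AlgebraicTopology.SingularHomology.SubsetCochains`:

* `NatCochain.Cohomology d n` — the cohomology `ker dⁿ / im dⁿ⁻¹` of an `ℕ`-indexed cochain complex
  of `R`-modules given by its differentials `d n : A n →ₗ[R] A (n + 1)` (as the sub-quotient
  `Z ⧸ B.comap Z.subtype`, the shape used throughout the tree), the induced maps
  `NatCochain.Cohomology.map` of a cochain map and **`NatCochain.Cohomology.bijective_map`**: a
  degreewise bijective cochain map induces bijections (`NatCochain.Cohomology.equivOfBijective`);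
* `ADoubleComplex R X` — an anticommuting double complex on a family `X : ℕ → ℕ → Type _`
  (vertical `d p q : X p q → X p (q+1)`, horizontal `δ p q : X p q → X (p+1) q`), its total
  differential `totalD = hPart + vPart` on the big module `Π p q, X p q`, the homogeneous pieces
  `Tn R n = {x | x p q = 0 unless p + q = n}` and the total complex `totD n : Tn n → Tn (n+1)`
  (`totalD_totalD : D ∘ D = 0`);
* `RowAugmentation K A` — a complex `A` mapping into the column `p = 0` (`ε`, commuting with `d`,
  killed by `δ`) and the induced `RowAugmentation.totMap : Hⁿ(A) → Hⁿ(Tot K)`;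
* **`RowAugmentation.bijective_totMap`** (Weibel 2.7.3 / Bott–Tu Prop. 8.8): if `ε` is injective
  with image `ker δ₀` and the rows of `K` are exact in positive columns (`ADoubleComplex.RowExact`),
  then `Hⁿ(A) → Hⁿ(Tot K)` is bijective for every `n` — proved by the elementary staircase
  induction on the column support of a homogeneous element;
* `ADoubleComplex.swap` (rows ↔ columns; no signs are needed in the anticommuting convention),
  `swapTotEquiv : Hⁿ(Tot K) ≃ Hⁿ(Tot K.swap)`, `ColAugmentation K B := RowAugmentation K.swap B`,
  and the conclusion used downstream, **`ADoubleComplex.rowColEquiv`**: for a double complex with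
  exact rows and exact columns, augmented on both sides, `Hⁿ(A) ≃ₗ[R] Hⁿ(B)` for all `n`.

To use a double complex with COMMUTING squares (e.g. Čech ∘ de Rham), replace `d p q` by
`(-1)^p • d p q` (Weibel's sign trick 1.2.5); kernels and images, hence all exactness hypotheses,
are unchanged.

Mathlib (pin v4.32) has total complexes of bicomplexes in preadditive categories
(`HomologicalComplex₂.total`) but no acyclic-assembly / exact-rows comparison theorem (searched:
`HomologicalComplex₂`, `total`, `Acyclic`, `rowExact`); the concrete route is also what the two
intended consumers need. No named facts; everything is proved.

## References

* C. A. Weibel, *An Introduction to Homological Algebra*, CUP 1994, §1.2.4–1.2.6, Lemma 2.7.3 and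
  the proof of Thm. 2.7.2 (pp. 58–60). [Weibel1994]
* R. Bott, L. W. Tu, *Differential Forms in Algebraic Topology*, GTM 82, Springer 1982, §8
  (Prop. 8.8, Thm. 8.9), §12. [BottTu1982Forms]
* G. E. Bredon, *Sheaf Theory*, 2nd ed., GTM 170, Springer 1997, Appendix A §2. [Bredon1997]
-/

namespace Literature.Algebra.Homology

universe u w w' w''

open Function

variable {R : Type u} [CommRing R]

/-! ### `ℕ`-indexed cochain complexes of modules, concretely -/

namespace NatCochain

variable {A : ℕ → Type w} [∀ n, AddCommGroup (A n)] [∀ n, Module R (A n)]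
  {A' : ℕ → Type w'} [∀ n, AddCommGroup (A' n)] [∀ n, Module R (A' n)]

/-- The cocycles `Zⁿ = ker dⁿ` of an `ℕ`-indexed cochain complex of modules given by its
differentials. [cite: Weibel1994, Def. 1.1.1] -/
def cocycles (d : ∀ n, A n →ₗ[R] A (n + 1)) (n : ℕ) : Submodule R (A n) :=
  LinearMap.ker (d n)

/-- The coboundaries `Bⁿ = im dⁿ⁻¹` (`0` in degree `0`; pattern matching avoids `n - 1`).
[cite: Weibel1994, Def. 1.1.1] -/
def coboundaries (d : ∀ n, A n →ₗ[R] A (n + 1)) : (n : ℕ) → Submodule R (A n)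
  | 0 => ⊥
  | n + 1 => LinearMap.range (d n)

/-- Membership in the cocycles. [folklore] -/
theorem mem_cocycles_iff (d : ∀ n, A n →ₗ[R] A (n + 1)) {n : ℕ} {x : A n} :
    x ∈ cocycles d n ↔ d n x = 0 :=
  LinearMap.mem_ker

/-- There are no coboundaries in degree `0`. [folklore] -/
@[simp]
theorem coboundaries_zero (d : ∀ n, A n →ₗ[R] A (n + 1)) : coboundaries d 0 = ⊥ :=
  rfl

/-- Membership in the coboundaries of positive degree. [folklore] -/
theorem mem_coboundaries_succ_iff (d : ∀ n, A n →ₗ[R] A (n + 1)) {n : ℕ} {x : A (n + 1)} :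
    x ∈ coboundaries d (n + 1) ↔ ∃ y, d n y = x :=
  LinearMap.mem_range

/-- **The cohomology `Hⁿ = Zⁿ / Bⁿ`** of an `ℕ`-indexed cochain complex of `R`-modules, as the
sub-quotient `Zⁿ ⧸ (Bⁿ ⊓ Zⁿ)` (no use is made of `d ∘ d = 0`, which only says `Bⁿ ≤ Zⁿ`).
[cite: Weibel1994, Def. 1.1.1] -/
def Cohomology (d : ∀ n, A n →ₗ[R] A (n + 1)) (n : ℕ) : Type w :=
  ↥(cocycles d n) ⧸ (coboundaries d n).comap (cocycles d n).subtype

/-- The additive group structure of the cohomology (quotient structure). [folklore] -/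
instance Cohomology.instAddCommGroup (d : ∀ n, A n →ₗ[R] A (n + 1)) (n : ℕ) :
    AddCommGroup (Cohomology d n) :=
  Submodule.Quotient.addCommGroup _

/-- The `R`-module structure of the cohomology (quotient structure). [folklore] -/
instance Cohomology.instModule (d : ∀ n, A n →ₗ[R] A (n + 1)) (n : ℕ) :
    Module R (Cohomology d n) :=
  Submodule.Quotient.module _

namespace Cohomology

/-- The class of a cocycle. [folklore] -/
def mk (d : ∀ n, A n →ₗ[R] A (n + 1)) (n : ℕ) : ↥(cocycles d n) →ₗ[R] Cohomology d n :=
  Submodule.mkQ _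

/-- Every class is the class of a cocycle. [folklore] -/
theorem mk_surjective (d : ∀ n, A n →ₗ[R] A (n + 1)) (n : ℕ) : Surjective (mk d n) :=
  Submodule.Quotient.mk_surjective _

/-- A class vanishes iff the cocycle is a coboundary. [folklore] -/
theorem mk_eq_zero_iff (d : ∀ n, A n →ₗ[R] A (n + 1)) {n : ℕ} (z : ↥(cocycles d n)) :
    mk d n z = 0 ↔ (z : A n) ∈ coboundaries d n := by
  change Submodule.Quotient.mk z =
    (0 : ↥(cocycles d n) ⧸ (coboundaries d n).comap (cocycles d n).subtype) ↔ _
  rw [Submodule.Quotient.mk_eq_zero, Submodule.mem_comap, Submodule.subtype_apply]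

/-- Two cocycles have the same class iff they differ by a coboundary. [folklore] -/
theorem mk_eq_mk_iff (d : ∀ n, A n →ₗ[R] A (n + 1)) {n : ℕ} (z z' : ↥(cocycles d n)) :
    mk d n z = mk d n z' ↔ (z : A n) - z' ∈ coboundaries d n := by
  rw [← sub_eq_zero, ← map_sub, mk_eq_zero_iff, Submodule.coe_sub]

section Map

variable {d : ∀ n, A n →ₗ[R] A (n + 1)} {d' : ∀ n, A' n →ₗ[R] A' (n + 1)}
  (f : ∀ n, A n →ₗ[R] A' n) (hf : ∀ n x, f (n + 1) (d n x) = d' n (f n x))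

include hf in
/-- A cochain map sends cocycles to cocycles. [folklore] -/
theorem map_mem_cocycles {n : ℕ} {x : A n} (hx : x ∈ cocycles d n) : f n x ∈ cocycles d' n := by
  rw [mem_cocycles_iff] at hx ⊢
  rw [← hf, hx, map_zero]

include hf in
/-- A cochain map sends coboundaries to coboundaries. [folklore] -/
theorem map_mem_coboundaries {n : ℕ} {x : A n} (hx : x ∈ coboundaries d n) :
    f n x ∈ coboundaries d' n := by
  cases n with
  | zero =>
    rw [coboundaries_zero, Submodule.mem_bot] at hx ⊢
    rw [hx, map_zero]
  | succ n =>
    obtain ⟨y, rfl⟩ := (mem_coboundaries_succ_iff d).1 hx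
    exact (mem_coboundaries_succ_iff d').2 ⟨f n y, (hf n y).symm⟩

/-- A cochain map restricted to cocycles. [folklore] -/
def mapCocycles (n : ℕ) : ↥(cocycles d n) →ₗ[R] ↥(cocycles d' n) :=
  (f n).restrict fun _ hx ↦ map_mem_cocycles f hf hx

/-- Underlying element of the image of a cocycle. [folklore] -/
@[simp]
theorem coe_mapCocycles {n : ℕ} (z : ↥(cocycles d n)) :
    (mapCocycles f hf n z : A' n) = f n z :=
  rfl

/-- **The map induced on cohomology by a cochain map.** [cite: Weibel1994, Def. 1.1.1] -/
def map (n : ℕ) : Cohomology d n →ₗ[R] Cohomology d' n :=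
  Submodule.mapQ _ _ (mapCocycles f hf n) fun z hz ↦ by
    simp only [Submodule.mem_comap, Submodule.subtype_apply] at hz ⊢
    exact map_mem_coboundaries f hf hz

/-- The induced map on the class of a cocycle. [folklore] -/
@[simp]
theorem map_mk {n : ℕ} (z : ↥(cocycles d n)) :
    map f hf n (mk d n z) = mk d' n (mapCocycles f hf n z) :=
  rfl

/-- **A degreewise bijective cochain map induces injections on cohomology** (bijectivity in
degree `n` and surjectivity in degree `n - 1` are what is used). [folklore] -/
theorem injective_map (hb : ∀ n, Bijective (f n)) (n : ℕ) : Injective (map f hf n) := by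
  intro c c' h
  obtain ⟨z, rfl⟩ := mk_surjective d n c
  obtain ⟨z', rfl⟩ := mk_surjective d n c'
  rw [map_mk, map_mk, mk_eq_mk_iff] at h
  rw [mk_eq_mk_iff]
  cases n with
  | zero =>
    rw [coboundaries_zero, Submodule.mem_bot] at h ⊢
    apply (hb 0).1
    rw [map_sub, map_zero]
    simpa using h
  | succ n =>
    obtain ⟨y', hy'⟩ := (mem_coboundaries_succ_iff d').1 h
    obtain ⟨y, rfl⟩ := (hb n).2 y'
    refine (mem_coboundaries_succ_iff d).2 ⟨y, (hb (n + 1)).1 ?_⟩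
    rw [hf, hy', map_sub]
    rfl

/-- **A degreewise bijective cochain map induces surjections on cohomology** (surjectivity in
degree `n` and injectivity in degree `n + 1` are what is used). [folklore] -/
theorem surjective_map (hb : ∀ n, Bijective (f n)) (n : ℕ) : Surjective (map f hf n) := by
  intro c'
  obtain ⟨z', rfl⟩ := mk_surjective d' n c'
  obtain ⟨x, hx⟩ := (hb n).2 (z' : A' n)
  have hxz : x ∈ cocycles d n := by
    rw [mem_cocycles_iff]
    apply (hb (n + 1)).1
    rw [hf, hx, map_zero]
    exact (mem_cocycles_iff d').1 z'.2
  refine ⟨mk d n ⟨x, hxz⟩, ?_⟩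
  rw [map_mk]
  congr 1
  exact Subtype.ext hx

/-- **A degreewise bijective cochain map induces bijections on cohomology.** [folklore] -/
theorem bijective_map (hb : ∀ n, Bijective (f n)) (n : ℕ) : Bijective (map f hf n) :=
  ⟨injective_map f hf hb n, surjective_map f hf hb n⟩

/-- **A degreewise bijective cochain map induces isomorphisms on cohomology.** [folklore] -/
noncomputable def equivOfBijective (hb : ∀ n, Bijective (f n)) (n : ℕ) :
    Cohomology d n ≃ₗ[R] Cohomology d' n :=
  LinearEquiv.ofBijective (map f hf n) (bijective_map f hf hb n)

/-- The isomorphism induced by a bijective cochain map is the induced map. [folklore] -/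
@[simp]
theorem equivOfBijective_apply (hb : ∀ n, Bijective (f n)) (n : ℕ) (c : Cohomology d n) :
    equivOfBijective f hf hb n c = map f hf n c :=
  rfl

end Map

end Cohomology

end NatCochain

/-! ### Anticommuting double complexes and their total complex -/

/-- An **anticommuting first-quadrant double complex** of `R`-modules on the family
`X : ℕ → ℕ → Type _` (Weibel (1994), 1.2.4: vertical `d`, horizontal `δ`, `d ∘ d = 0`, `δ ∘ δ = 0`,
`δ d + d δ = 0`; for a double complex with commuting squares use `(-1)^p d` as vertical
differential, Weibel's sign trick 1.2.5). [cite: Weibel1994, 1.2.4–1.2.5] -/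
structure ADoubleComplex (R : Type u) [CommRing R] (X : ℕ → ℕ → Type w)
    [∀ p q, AddCommGroup (X p q)] [∀ p q, Module R (X p q)] where
  /-- the vertical differential `d : X p q → X p (q + 1)` -/
  d : ∀ p q, X p q →ₗ[R] X p (q + 1)
  /-- the horizontal differential `δ : X p q → X (p + 1) q` -/
  δ : ∀ p q, X p q →ₗ[R] X (p + 1) q
  /-- `d ∘ d = 0` -/
  d_d : ∀ p q (x : X p q), d p (q + 1) (d p q x) = 0
  /-- `δ ∘ δ = 0` -/
  δ_δ : ∀ p q (x : X p q), δ (p + 1) q (δ p q x) = 0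
  /-- the squares anticommute -/
  anticomm : ∀ p q (x : X p q), δ p (q + 1) (d p q x) + d (p + 1) q (δ p q x) = 0

namespace ADoubleComplex

variable {X : ℕ → ℕ → Type w} [∀ p q, AddCommGroup (X p q)] [∀ p q, Module R (X p q)]

/-! #### The big module `Π p q, X p q`: single entries, homogeneous pieces, column support -/

/-- The element of `Π p q, X p q` with the single entry `v` at `(p, q)`. [folklore] -/
def single (p q : ℕ) (v : X p q) : ∀ p' q', X p' q' :=
  Pi.single p (Pi.single q v : ∀ q', X p q')

/-- The entry of `single p q v` at `(p, q)` is `v`. [folklore] -/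
@[simp]
theorem single_apply_same (p q : ℕ) (v : X p q) : single p q v p q = v := by
  simp [single]

/-- The entries of `single p q v` off the column `p` vanish. [folklore] -/
theorem single_apply_of_ne_fst {p q p' : ℕ} (h : p' ≠ p) (v : X p q) (q' : ℕ) :
    single p q v p' q' = 0 := by
  simp [single, Pi.single_eq_of_ne h]

/-- The entries of `single p q v` off the row `q` vanish. [folklore] -/
theorem single_apply_of_ne_snd {p q q' : ℕ} (h : q' ≠ q) (v : X p q) (p' : ℕ) :
    single p q v p' q' = 0 := by
  by_cases hp : p' = p
  · subst hp
    simp [single, Pi.single_eq_of_ne h]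
  · exact single_apply_of_ne_fst hp v q'

/-- The entries of `single p q v` off `(p, q)` vanish. [folklore] -/
theorem single_apply_of_ne {p q p' q' : ℕ} (h : p' ≠ p ∨ q' ≠ q) (v : X p q) :
    single p q v p' q' = 0 :=
  h.elim (fun h ↦ single_apply_of_ne_fst h v q') (fun h ↦ single_apply_of_ne_snd h v p')

/-- `single p q` is additive. [folklore] -/
theorem single_add (p q : ℕ) (v w : X p q) : single p q (v + w) = single p q v + single p q w := by
  simp [single, Pi.single_add]

/-- `single p q` commutes with scalars. [folklore] -/
theorem single_smul (p q : ℕ) (c : R) (v : X p q) : single p q (c • v) = c • single p q v := by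
  simp [single, Pi.single_smul]

/-- `single p q 0 = 0`. [folklore] -/
@[simp]
theorem single_zero (p q : ℕ) : single p q (0 : X p q) = 0 := by
  simp [single]

variable (R) in
/-- `single p q` as an `R`-linear map. [folklore] -/
def singleₗ (p q : ℕ) : X p q →ₗ[R] (∀ p' q', X p' q') where
  toFun := single p q
  map_add' := single_add p q
  map_smul' := single_smul p q

/-- `singleₗ` is `single`. [folklore] -/
@[simp]
theorem singleₗ_apply (p q : ℕ) (v : X p q) : singleₗ R p q v = single p q v :=
  rfl

variable (R) in
/-- The homogeneous piece of total degree `n`: families supported on `p + q = n`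
(Weibel (1994), 1.2.6, `Tot(C)ⁿ = ⊕_{p+q=n} C^{p,q}`, realised inside `Π p q, X p q`).
[cite: Weibel1994, 1.2.6] -/
def Tn (n : ℕ) : Submodule R (∀ p q, X p q) where
  carrier := {x | ∀ p q, p + q ≠ n → x p q = 0}
  add_mem' {x y} hx hy p q h := by simp [hx p q h, hy p q h]
  zero_mem' _ _ _ := rfl
  smul_mem' c x hx p q h := by simp [hx p q h]

/-- Membership in a homogeneous piece. [folklore] -/
theorem mem_Tn_iff {n : ℕ} {x : ∀ p q, X p q} : x ∈ Tn R n ↔ ∀ p q, p + q ≠ n → x p q = 0 :=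
  Iff.rfl

variable (R) in
/-- A single entry at `(p, q)` is homogeneous of degree `p + q`. [folklore] -/
theorem single_mem_Tn (p q : ℕ) (v : X p q) : single p q v ∈ Tn R (p + q) := by
  intro p' q' h
  apply single_apply_of_ne
  omega

/-- **Column support**: `x` has no entries in the columns `> j`. [folklore] -/
def ColLE (x : ∀ p q, X p q) (j : ℕ) : Prop :=
  ∀ p q, j < p → x p q = 0

/-- A homogeneous element of degree `n` is supported on the columns `≤ n`. [folklore] -/
theorem colLE_of_mem_Tn {n : ℕ} {x : ∀ p q, X p q} (hx : x ∈ Tn R n) : ColLE x n :=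
  fun p q hp ↦ hx p q (by omega)

/-- A homogeneous element of degree `n ≤ j` supported on the columns `≤ j + 1` is supported on
the columns `≤ j`. [folklore] -/
theorem colLE_of_le {n j : ℕ} {x : ∀ p q, X p q} (hx : x ∈ Tn R n) (hcol : ColLE x (j + 1))
    (hn : n ≤ j) : ColLE x j := by
  intro p q hp
  by_cases hpj : p = j + 1
  · exact hx p q (by omega)
  · exact hcol p q (by omega)

/-- A homogeneous element of degree `n` supported on the column `0` is a single entry at
`(0, n)`. [folklore] -/
theorem eq_single_of_colLE_zero {n : ℕ} {x : ∀ p q, X p q} (hx : x ∈ Tn R n)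
    (hcol : ColLE x 0) : x = single 0 n (x 0 n) := by
  funext p q
  rcases p with _ | p
  · by_cases hq : q = n
    · subst hq
      rw [single_apply_same]
    · rw [single_apply_of_ne_snd hq, hx 0 q (by omega)]
  · rw [hcol (p + 1) q (by omega), single_apply_of_ne_fst (by omega)]

/-! #### The total differential -/

variable (K : ADoubleComplex R X)

/-- The anticommutation in solved form: `δ (d x) = - d (δ x)`. [cite: Weibel1994, 1.2.4] -/
theorem δ_d (p q : ℕ) (x : X p q) : K.δ p (q + 1) (K.d p q x) = -K.d (p + 1) q (K.δ p q x) :=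
  eq_neg_of_add_eq_zero_left (K.anticomm p q x)

/-- **Row exactness in positive columns**: `ker δ_{p+1} ⊆ im δ_p` in every row. (Exactness at
the column `p = 0` is part of the augmentation data, `RowAugmentation.Exact`.) A one-field
structure (a hypothesis on `K`, not a statement). [cite: Weibel1994, Lemma 2.7.3] -/
structure RowExact : Prop where
  /-- `ker δ_{p+1} ⊆ im δ_p` -/
  exact : ∀ p q (x : X (p + 1) q), K.δ (p + 1) q x = 0 → ∃ y : X p q, K.δ p q y = x

/-- **Column exactness in positive rows**: `ker d_{q+1} ⊆ im d_q` in every column. A one-field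
structure (a hypothesis on `K`, not a statement). [cite: Weibel1994, Lemma 2.7.3] -/
structure ColExact : Prop where
  /-- `ker d_{q+1} ⊆ im d_q` -/
  exact : ∀ p q (x : X p (q + 1)), K.d p (q + 1) x = 0 → ∃ y : X p q, K.d p q y = x

/-- The horizontal part of the total differential as a bare function:
`(δ x)_{p+1,q} = δ x_{p,q}`, `(δ x)_{0,q} = 0`. [cite: Weibel1994, 1.2.6] -/
def hFun (x : ∀ p q, X p q) : ∀ p q, X p q
  | 0, _ => 0
  | p + 1, q => K.δ p q (x p q)

/-- The vertical part of the total differential as a bare function: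
`(d x)_{p,q+1} = d x_{p,q}`, `(d x)_{p,0} = 0`. [cite: Weibel1994, 1.2.6] -/
def vFun (x : ∀ p q, X p q) : ∀ p q, X p q
  | _, 0 => 0
  | p, q + 1 => K.d p q (x p q)

/-- The horizontal part of the total differential. [cite: Weibel1994, 1.2.6] -/
def hPart : (∀ p q, X p q) →ₗ[R] (∀ p q, X p q) where
  toFun := K.hFun
  map_add' x y := by
    funext p q
    cases p <;> simp [hFun]
  map_smul' c x := by
    funext p q
    cases p <;> simp [hFun]

/-- The vertical part of the total differential. [cite: Weibel1994, 1.2.6] -/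
def vPart : (∀ p q, X p q) →ₗ[R] (∀ p q, X p q) where
  toFun := K.vFun
  map_add' x y := by
    funext p q
    cases q <;> simp [vFun]
  map_smul' c x := by
    funext p q
    cases q <;> simp [vFun]

/-- **The total differential `D = δ + d`** on `Π p q, X p q` (Weibel (1994), 1.2.6).
[cite: Weibel1994, 1.2.6] -/
def totalD : (∀ p q, X p q) →ₗ[R] (∀ p q, X p q) :=
  K.hPart + K.vPart

/-- `(δ x)_{0,q} = 0`. [folklore] -/
@[simp]
theorem hPart_apply_zero (x : ∀ p q, X p q) (q : ℕ) : K.hPart x 0 q = 0 :=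
  rfl

/-- `(δ x)_{p+1,q} = δ x_{p,q}`. [folklore] -/
@[simp]
theorem hPart_apply_succ (x : ∀ p q, X p q) (p q : ℕ) : K.hPart x (p + 1) q = K.δ p q (x p q) :=
  rfl

/-- `(d x)_{p,0} = 0`. [folklore] -/
@[simp]
theorem vPart_apply_zero (x : ∀ p q, X p q) (p : ℕ) : K.vPart x p 0 = 0 := by
  cases p <;> rfl

/-- `(d x)_{p,q+1} = d x_{p,q}`. [folklore] -/
@[simp]
theorem vPart_apply_succ (x : ∀ p q, X p q) (p q : ℕ) : K.vPart x p (q + 1) = K.d p q (x p q) := by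
  cases p <;> rfl

/-- The total differential, entrywise. [cite: Weibel1994, 1.2.6] -/
theorem totalD_apply (x : ∀ p q, X p q) (p q : ℕ) :
    K.totalD x p q = K.hPart x p q + K.vPart x p q :=
  rfl

/-- The entry `(0, 0)` of `D x` vanishes. [folklore] -/
@[simp]
theorem totalD_apply_zero_zero (x : ∀ p q, X p q) : K.totalD x 0 0 = 0 := by
  rw [totalD_apply, hPart_apply_zero, vPart_apply_zero, add_zero]

/-- The entries of `D x` in the column `0`: `(D x)_{0,q+1} = d x_{0,q}`. [folklore] -/
@[simp]
theorem totalD_apply_zero_succ (x : ∀ p q, X p q) (q : ℕ) :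
    K.totalD x 0 (q + 1) = K.d 0 q (x 0 q) := by
  rw [totalD_apply, hPart_apply_zero, vPart_apply_succ, zero_add]

/-- The entries of `D x` in the row `0`: `(D x)_{p+1,0} = δ x_{p,0}`. [folklore] -/
@[simp]
theorem totalD_apply_succ_zero (x : ∀ p q, X p q) (p : ℕ) :
    K.totalD x (p + 1) 0 = K.δ p 0 (x p 0) := by
  rw [totalD_apply, hPart_apply_succ, vPart_apply_zero, add_zero]

/-- The general entry `(D x)_{p+1,q+1} = δ x_{p,q+1} + d x_{p+1,q}`. [folklore] -/
theorem totalD_apply_succ_succ (x : ∀ p q, X p q) (p q : ℕ) :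
    K.totalD x (p + 1) (q + 1) = K.δ p (q + 1) (x p (q + 1)) + K.d (p + 1) q (x (p + 1) q) := by
  rw [totalD_apply, hPart_apply_succ, vPart_apply_succ]

/-- If the column `p + 1` of `x` vanishes, then `(D x)_{p+1,q} = δ x_{p,q}`. [folklore] -/
theorem totalD_apply_succ_of_col_eq_zero {x : ∀ p q, X p q} {p : ℕ} (h : ∀ q, x (p + 1) q = 0)
    (q : ℕ) : K.totalD x (p + 1) q = K.δ p q (x p q) := by
  cases q with
  | zero => exact K.totalD_apply_succ_zero x p
  | succ q => rw [totalD_apply_succ_succ, h q, map_zero, add_zero]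

/-- If the columns `≥ p` of `x` vanish, then the columns `≥ p + 1` of `D x` vanish. [folklore] -/
theorem totalD_apply_eq_zero_of_cols {x : ∀ p q, X p q} {p : ℕ}
    (h : ∀ p' q, p ≤ p' → x p' q = 0) {p' : ℕ} (hp' : p + 1 ≤ p') (q : ℕ) :
    K.totalD x p' q = 0 := by
  obtain ⟨p'', rfl⟩ : ∃ p'', p' = p'' + 1 := ⟨p' - 1, by omega⟩
  rw [K.totalD_apply_succ_of_col_eq_zero (p := p'') (fun q ↦ h _ q (by omega)), h p'' q (by omega),
    map_zero]

/-- **`D ∘ D = 0`** (this is where anticommutation is used; Weibel (1994), 1.2.6).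
[cite: Weibel1994, 1.2.6] -/
theorem totalD_totalD (x : ∀ p q, X p q) : K.totalD (K.totalD x) = 0 := by
  funext p q
  rcases p with _ | p <;> rcases q with _ | q
  · rw [totalD_apply_zero_zero]
    rfl
  · rw [totalD_apply_zero_succ]
    cases q with
    | zero => rw [totalD_apply_zero_zero, map_zero]; rfl
    | succ q => rw [totalD_apply_zero_succ, K.d_d]; rfl
  · rw [totalD_apply_succ_zero]
    cases p with
    | zero => rw [totalD_apply_zero_zero, map_zero]; rfl
    | succ p => rw [totalD_apply_succ_zero, K.δ_δ]; rfl
  · rw [totalD_apply_succ_succ]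
    have h1 : K.δ p (q + 1) (K.totalD x p (q + 1)) = K.δ p (q + 1) (K.d p q (x p q)) := by
      cases p with
      | zero => rw [totalD_apply_zero_succ]
      | succ p => rw [totalD_apply_succ_succ, map_add, K.δ_δ, zero_add]
    have h2 : K.d (p + 1) q (K.totalD x (p + 1) q) = K.d (p + 1) q (K.δ p q (x p q)) := by
      cases q with
      | zero => rw [totalD_apply_succ_zero]
      | succ q => rw [totalD_apply_succ_succ, map_add, K.d_d, add_zero]
    rw [h1, h2, K.anticomm]
    rfl

/-- `D` raises the total degree by one. [cite: Weibel1994, 1.2.6] -/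
theorem totalD_mem_Tn {n : ℕ} {x : ∀ p q, X p q} (hx : x ∈ Tn R n) :
    K.totalD x ∈ Tn R (n + 1) := by
  intro p q h
  rw [totalD_apply]
  have h1 : K.hPart x p q = 0 := by
    cases p with
    | zero => rfl
    | succ p => rw [hPart_apply_succ, hx p q (by omega), map_zero]
  have h2 : K.vPart x p q = 0 := by
    cases q with
    | zero => exact K.vPart_apply_zero x p
    | succ q => rw [vPart_apply_succ, hx p q (by omega), map_zero]
  rw [h1, h2, add_zero]

/-- **`D` of a single entry**: `D (v at (p,q)) = (δ v at (p+1,q)) + (d v at (p,q+1))`.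
[cite: Weibel1994, 1.2.6] -/
theorem totalD_single (p q : ℕ) (v : X p q) :
    K.totalD (single p q v) = single (p + 1) q (K.δ p q v) + single p (q + 1) (K.d p q v) := by
  funext p' q'
  rw [Pi.add_apply, Pi.add_apply, totalD_apply]
  congr 1
  · -- horizontal part
    cases p' with
    | zero =>
      rw [hPart_apply_zero]
      exact (single_apply_of_ne_fst (by omega) _ _).symm
    | succ p' =>
      rw [hPart_apply_succ]
      by_cases h : p' = p ∧ q' = q
      · obtain ⟨rfl, rfl⟩ := h
        rw [single_apply_same, single_apply_same]
      · have h' : p' + 1 ≠ p + 1 ∨ q' ≠ q := by omega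
        rw [single_apply_of_ne (not_and_or.1 h), map_zero, single_apply_of_ne h']
  · -- vertical part
    cases q' with
    | zero =>
      rw [vPart_apply_zero]
      exact (single_apply_of_ne_snd (by omega) _ _).symm
    | succ q' =>
      rw [vPart_apply_succ]
      by_cases h : p' = p ∧ q' = q
      · obtain ⟨rfl, rfl⟩ := h
        rw [single_apply_same, single_apply_same]
      · have h' : p' ≠ p ∨ q' + 1 ≠ q + 1 := by omega
        rw [single_apply_of_ne (not_and_or.1 h), map_zero, single_apply_of_ne h']

/-! #### The total complex and its cohomology -/

/-- **The total complex**: `D` restricted to the homogeneous pieces, `Totⁿ → Totⁿ⁺¹`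
(Weibel (1994), 1.2.6). [cite: Weibel1994, 1.2.6] -/
def totD (n : ℕ) : ↥(Tn R (X := X) n) →ₗ[R] ↥(Tn R (X := X) (n + 1)) :=
  K.totalD.restrict fun _ hx ↦ K.totalD_mem_Tn hx

/-- Underlying family of `totD`. [folklore] -/
@[simp]
theorem coe_totD {n : ℕ} (x : ↥(Tn R (X := X) n)) :
    (K.totD n x : ∀ p q, X p q) = K.totalD x :=
  rfl

/-- The coboundaries of the total complex as submodules of the big module: `0` in degree `0`,
`D (Totⁿ)` in degree `n + 1`. [folklore] -/
def totB : (n : ℕ) → Submodule R (∀ p q, X p q)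
  | 0 => ⊥
  | n + 1 => (Tn R n).map K.totalD

/-- `totB 0 = 0`. [folklore] -/
@[simp]
theorem totB_zero : K.totB 0 = ⊥ :=
  rfl

/-- `totB (n + 1) = D (Totⁿ)`. [folklore] -/
@[simp]
theorem totB_succ (n : ℕ) : K.totB (n + 1) = (Tn R n).map K.totalD :=
  rfl

/-- A homogeneous cochain of the total complex is a total coboundary iff its underlying family
lies in `totB`. [folklore] -/
theorem mem_coboundaries_totD_iff {n : ℕ} (z : ↥(Tn R (X := X) n)) :
    (z : ∀ p q, X p q) ∈ K.totB n ↔ z ∈ NatCochain.coboundaries K.totD n := by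
  cases n with
  | zero => simp
  | succ n =>
    rw [NatCochain.mem_coboundaries_succ_iff, totB_succ, Submodule.mem_map]
    constructor
    · rintro ⟨y, hy, hyz⟩
      exact ⟨⟨y, hy⟩, Subtype.ext hyz⟩
    · rintro ⟨y, rfl⟩
      exact ⟨y, y.2, rfl⟩

/-! ### Row augmentations -/

/-- A **row augmentation** of the double complex `K`: a graded module `A` with differential `dA`
and maps `ε : Aⁿ → X 0 n` into the column `p = 0`, commuting with the vertical differential and
killed by the horizontal one (Weibel (1994), proof of Thm. 2.7.2: "the double complex obtained
from `P ⊗ Q` by adding `A ⊗ Q[-1]` in the column `p = -1`"; Bott–Tu (1982), §8, the restriction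
`r : Ω(M) → C⁰(𝔘, Ω)`). `dA ∘ dA = 0` is not recorded (it is never used).
[cite: Weibel1994, Thm. 2.7.2 (proof)] -/
structure RowAugmentation (A : ℕ → Type w') [∀ n, AddCommGroup (A n)] [∀ n, Module R (A n)] where
  /-- the differential of the augmentation complex -/
  dA : ∀ n, A n →ₗ[R] A (n + 1)
  /-- the augmentation maps into the column `p = 0` -/
  ε : ∀ n, A n →ₗ[R] X 0 n
  /-- `ε` is a cochain map for the vertical differential -/
  ε_dA : ∀ n (a : A n), ε (n + 1) (dA n a) = K.d 0 n (ε n a)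
  /-- `ε` is killed by the horizontal differential -/
  δ_ε : ∀ n (a : A n), K.δ 0 n (ε n a) = 0

variable {K}
variable {A : ℕ → Type w'} [∀ n, AddCommGroup (A n)] [∀ n, Module R (A n)]

namespace RowAugmentation

variable (E : K.RowAugmentation A)

/-- **Exactness of the augmented rows at the column `p = 0`**: `ε` is injective with image
`ker δ₀`. [cite: Weibel1994, Lemma 2.7.3] -/
structure Exact : Prop where
  /-- `ε` is injective -/
  injective : ∀ n, Injective (E.ε n)
  /-- `ker δ₀ ⊆ im ε` -/
  exact : ∀ n (x : X 0 n), K.δ 0 n x = 0 → ∃ a, E.ε n a = x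

/-- The augmentation followed by the inclusion of the column `0` into the total complex:
`a ↦ (ε a at (0, n)) ∈ Totⁿ`. [cite: Weibel1994, Thm. 2.7.2 (proof)] -/
def εTot (n : ℕ) : A n →ₗ[R] ↥(Tn R (X := X) n) :=
  LinearMap.codRestrict (Tn R n) (singleₗ R 0 n ∘ₗ E.ε n) fun a ↦ by
    simpa using single_mem_Tn R 0 n (E.ε n a)

/-- Underlying family of `εTot`. [folklore] -/
@[simp]
theorem coe_εTot (n : ℕ) (a : A n) : (E.εTot n a : ∀ p q, X p q) = single 0 n (E.ε n a) :=
  rfl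

/-- `D (ε a at (0,n)) = (ε (dA a) at (0, n+1))`. [cite: Weibel1994, Thm. 2.7.2 (proof)] -/
theorem totalD_single_ε (n : ℕ) (a : A n) :
    K.totalD (single 0 n (E.ε n a)) = single 0 (n + 1) (E.ε (n + 1) (E.dA n a)) := by
  rw [totalD_single, E.δ_ε, single_zero, zero_add, E.ε_dA]

/-- `εTot` is a cochain map `A → Tot K`. [cite: Weibel1994, Thm. 2.7.2 (proof)] -/
theorem totD_εTot (n : ℕ) (a : A n) : K.totD n (E.εTot n a) = E.εTot (n + 1) (E.dA n a) :=
  Subtype.ext (E.totalD_single_ε n a)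

/-- **The map `Hⁿ(A) → Hⁿ(Tot K)` induced by the augmentation.**
[cite: Weibel1994, Thm. 2.7.2 (proof)] -/
def totMap (n : ℕ) : NatCochain.Cohomology E.dA n →ₗ[R] NatCochain.Cohomology K.totD n :=
  NatCochain.Cohomology.map E.εTot (fun n a ↦ (E.totD_εTot n a).symm) n

/-- `totMap` on the class of a cocycle. [folklore] -/
theorem totMap_mk (n : ℕ) (a : ↥(NatCochain.cocycles E.dA n)) :
    E.totMap n (NatCochain.Cohomology.mk E.dA n a) =
      NatCochain.Cohomology.mk K.totD n
        (NatCochain.Cohomology.mapCocycles E.εTot (fun n a ↦ (E.totD_εTot n a).symm) n a) :=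
  rfl

/-! #### The staircase: reduction of the column support -/

/-- **One step down the staircase.** A homogeneous `w` of degree `j + 1 + m` supported on the
columns `≤ j + 1` whose differential has no entry at `(j + 2, m)` is, modulo `D` of a single entry
at `(j, m)`, supported on the columns `≤ j` (row exactness at the column `j + 1`).
[cite: Weibel1994, Lemma 2.7.3 (proof)] -/
theorem exists_reduce (hK : K.RowExact) {j m : ℕ} {w : ∀ p q, X p q}
    (hw : w ∈ Tn R (j + 1 + m)) (hcol : ColLE w (j + 1)) (h0 : K.totalD w (j + 1 + 1) m = 0) :
    ∃ z : X j m, ColLE (w - K.totalD (single j m z)) j := by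
  have hcolz : ∀ q, w (j + 1 + 1) q = 0 := fun q ↦ hcol _ q (by omega)
  rw [K.totalD_apply_succ_of_col_eq_zero hcolz] at h0
  obtain ⟨z, hz⟩ := hK.exact j m _ h0
  refine ⟨z, fun p q hp ↦ ?_⟩
  rw [Pi.sub_apply, Pi.sub_apply]
  rcases Nat.lt_or_ge (j + 1) p with hp' | hp'
  · -- the columns `≥ j + 2`: both entries vanish
    have hs : ∀ p' q', j + 1 ≤ p' → single j m z p' q' = 0 :=
      fun p' q' hp'' ↦ single_apply_of_ne_fst (by omega) z q'
    have hD0 : K.totalD (single j m z) p q = 0 := K.totalD_apply_eq_zero_of_cols hs (by omega) q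
    rw [hcol p q hp', hD0, sub_zero]
  · -- the column `j + 1`
    obtain rfl : p = j + 1 := by omega
    rw [K.totalD_apply_succ_of_col_eq_zero (p := j) (fun q' ↦ single_apply_of_ne_fst (by omega) z q')]
    by_cases hq : q = m
    · subst hq
      rw [single_apply_same, hz, sub_self]
    · rw [single_apply_of_ne_snd hq, map_zero, sub_zero]
      exact hw _ _ (by omega)

/-- **Surjectivity core.** Every homogeneous `D`-cocycle of degree `n` supported on the columns
`≤ j` is, modulo total coboundaries, the image of a cocycle of `A` (induction on `j`, descending
the staircase). [cite: Weibel1994, Lemma 2.7.3 (proof)] -/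
theorem exists_cocycle_of_colLE (hK : K.RowExact) (hE : E.Exact) (n j : ℕ) :
    ∀ x : ∀ p q, X p q, x ∈ Tn R n → K.totalD x = 0 → ColLE x j →
      ∃ a : A n, E.dA n a = 0 ∧ x - single 0 n (E.ε n a) ∈ K.totB n := by
  induction j with
  | zero =>
    intro x hx hD hcol
    have hx0 := eq_single_of_colLE_zero hx hcol
    have hδ : K.δ 0 n (x 0 n) = 0 := by
      have h := congrFun (congrFun hD 1) n
      rw [K.totalD_apply_succ_of_col_eq_zero (fun q ↦ hcol 1 q Nat.one_pos)] at h
      exact h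
    obtain ⟨a, ha⟩ := hE.exact n _ hδ
    refine ⟨a, hE.injective (n + 1) ?_, ?_⟩
    · rw [E.ε_dA, ha, map_zero, ← K.totalD_apply_zero_succ x n, hD]
      rfl
    · rw [ha, ← hx0, sub_self]
      exact zero_mem _
  | succ j ih =>
    intro x hx hD hcol
    rcases Nat.lt_or_ge j n with hnj | hnj
    · -- `n = j + 1 + m`: reduce the column support
      obtain ⟨m, rfl⟩ : ∃ m, n = j + 1 + m := ⟨n - (j + 1), by omega⟩
      have h0 : K.totalD x (j + 1 + 1) m = 0 := by rw [hD]; rfl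
      obtain ⟨z, hz⟩ := exists_reduce hK hx hcol h0
      have hs : K.totalD (single j m z) ∈ Tn R (j + 1 + m) := by
        have h := K.totalD_mem_Tn (single_mem_Tn R j m z)
        rwa [show j + m + 1 = j + 1 + m by omega] at h
      obtain ⟨a, ha, hmem⟩ :=
        ih _ (sub_mem hx hs) (by rw [map_sub, hD, totalD_totalD, sub_zero]) hz
      refine ⟨a, ha, ?_⟩
      have heq : x - single 0 (j + 1 + m) (E.ε (j + 1 + m) a) =
          (x - K.totalD (single j m z) - single 0 (j + 1 + m) (E.ε (j + 1 + m) a)) +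
            K.totalD (single j m z) := by abel
      rw [heq]
      refine add_mem hmem ?_
      rw [show j + 1 + m = (j + m) + 1 by omega, totB_succ]
      exact Submodule.mem_map_of_mem (single_mem_Tn R j m z)
    · exact ih x hx hD (colLE_of_le hx hcol hnj)

/-- **Injectivity core.** If `D y = (ε a at (0, n+1))` for a homogeneous `y` of degree `n`
supported on the columns `≤ j`, then `a` is a coboundary of `A` (induction on `j`).
[cite: Weibel1994, Lemma 2.7.3 (proof)] -/
theorem exists_dA_eq_of_colLE (hK : K.RowExact) (hE : E.Exact) (n j : ℕ) :
    ∀ (a : A (n + 1)) (y : ∀ p q, X p q), y ∈ Tn R n → ColLE y j →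
      K.totalD y = single 0 (n + 1) (E.ε (n + 1) a) → ∃ a' : A n, E.dA n a' = a := by
  induction j with
  | zero =>
    intro a y hy hcol hD
    have hδ : K.δ 0 n (y 0 n) = 0 := by
      have h := congrFun (congrFun hD 1) n
      rwa [K.totalD_apply_succ_of_col_eq_zero (fun q ↦ hcol 1 q Nat.one_pos),
        single_apply_of_ne_fst Nat.one_ne_zero] at h
    obtain ⟨a', ha'⟩ := hE.exact n _ hδ
    refine ⟨a', hE.injective (n + 1) ?_⟩
    rw [E.ε_dA, ha', ← K.totalD_apply_zero_succ y n, hD, single_apply_same]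
  | succ j ih =>
    intro a y hy hcol hD
    rcases Nat.lt_or_ge j n with hnj | hnj
    · obtain ⟨m, rfl⟩ : ∃ m, n = j + 1 + m := ⟨n - (j + 1), by omega⟩
      have h0 : K.totalD y (j + 1 + 1) m = 0 := by
        rw [hD]
        exact single_apply_of_ne_fst (by omega) _ _
      obtain ⟨z, hz⟩ := exists_reduce hK hy hcol h0
      have hs : K.totalD (single j m z) ∈ Tn R (j + 1 + m) := by
        have h := K.totalD_mem_Tn (single_mem_Tn R j m z)
        rwa [show j + m + 1 = j + 1 + m by omega] at h
      exact ih a _ (sub_mem hy hs) hz (by rw [map_sub, hD, totalD_totalD, sub_zero])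
    · exact ih a y hy (colLE_of_le hy hcol hnj) hD

/-- **Weibel's Acyclic Assembly Lemma / Bott–Tu's generalized Mayer–Vietoris principle,
surjectivity half**: for a row-exact augmented double complex every total cohomology class comes
from `A`. [cite: Weibel1994, Lemma 2.7.3] -/
theorem surjective_totMap (hK : K.RowExact) (hE : E.Exact) (n : ℕ) : Surjective (E.totMap n) := by
  intro c
  obtain ⟨z, rfl⟩ := NatCochain.Cohomology.mk_surjective K.totD n c
  have hzD : K.totalD (z : ∀ p q, X p q) = 0 := by
    have h := (NatCochain.mem_cocycles_iff K.totD).1 z.2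
    rw [Subtype.ext_iff, coe_totD] at h
    exact h
  obtain ⟨a, ha, hmem⟩ :=
    E.exists_cocycle_of_colLE hK hE n n z z.1.2 hzD (colLE_of_mem_Tn z.1.2)
  refine ⟨NatCochain.Cohomology.mk E.dA n ⟨a, (NatCochain.mem_cocycles_iff E.dA).2 ha⟩, ?_⟩
  rw [totMap_mk, NatCochain.Cohomology.mk_eq_mk_iff, ← K.mem_coboundaries_totD_iff,
    Submodule.coe_sub, NatCochain.Cohomology.coe_mapCocycles, coe_εTot, ← neg_sub]
  exact neg_mem hmem

/-- **Weibel's Acyclic Assembly Lemma / Bott–Tu's generalized Mayer–Vietoris principle,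
injectivity half**: for a row-exact augmented double complex a class of `A` dying in the total
complex is zero. [cite: Weibel1994, Lemma 2.7.3] -/
theorem injective_totMap (hK : K.RowExact) (hE : E.Exact) (n : ℕ) : Injective (E.totMap n) := by
  rw [injective_iff_map_eq_zero]
  intro c hc
  obtain ⟨a, rfl⟩ := NatCochain.Cohomology.mk_surjective E.dA n c
  rw [totMap_mk, NatCochain.Cohomology.mk_eq_zero_iff, ← K.mem_coboundaries_totD_iff,
    NatCochain.Cohomology.coe_mapCocycles, coe_εTot] at hc
  rw [NatCochain.Cohomology.mk_eq_zero_iff]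
  cases n with
  | zero =>
    rw [totB_zero, Submodule.mem_bot] at hc
    rw [NatCochain.coboundaries_zero, Submodule.mem_bot]
    apply hE.injective 0
    rw [map_zero, ← single_apply_same 0 0 (E.ε 0 (a : A 0)), hc]
    rfl
  | succ n =>
    rw [totB_succ, Submodule.mem_map] at hc
    obtain ⟨y, hy, hD⟩ := hc
    obtain ⟨a', ha'⟩ :=
      E.exists_dA_eq_of_colLE hK hE n n (a : A (n + 1)) y hy (colLE_of_mem_Tn hy) hD
    exact (NatCochain.mem_coboundaries_succ_iff E.dA).2 ⟨a', ha'⟩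

/-- **Row-exact augmented double complexes: the augmentation computes the total cohomology**,
`Hⁿ(A) → Hⁿ(Tot K)` is bijective (Weibel (1994), Acyclic Assembly Lemma 2.7.3 with the proof of
Thm. 2.7.2; Bott–Tu (1982), Prop. 8.8). [cite: Weibel1994, Lemma 2.7.3] -/
theorem bijective_totMap (hK : K.RowExact) (hE : E.Exact) (n : ℕ) : Bijective (E.totMap n) :=
  ⟨E.injective_totMap hK hE n, E.surjective_totMap hK hE n⟩

/-- The isomorphism `Hⁿ(A) ≃ Hⁿ(Tot K)` of a row-exact augmented double complex.
[cite: Weibel1994, Lemma 2.7.3] -/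
noncomputable def totEquiv (hK : K.RowExact) (hE : E.Exact) (n : ℕ) :
    NatCochain.Cohomology E.dA n ≃ₗ[R] NatCochain.Cohomology K.totD n :=
  LinearEquiv.ofBijective (E.totMap n) (E.bijective_totMap hK hE n)

end RowAugmentation

/-! ### Rows versus columns: the swapped double complex -/

variable (K)

/-- **The swapped double complex** `K.swap p q = K q p`, with the roles of `d` and `δ` exchanged
(in the anticommuting convention no signs are needed; Weibel (1994), proof of 2.7.3:
"interchanging rows and columns"). [cite: Weibel1994, Lemma 2.7.3 (proof)] -/
def swap : ADoubleComplex R (fun p q ↦ X q p) where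
  d p q := K.δ q p
  δ p q := K.d q p
  d_d p q x := K.δ_δ q p x
  δ_δ p q x := K.d_d q p x
  anticomm p q x := (add_comm _ _).trans (K.anticomm q p x)

/-- Row exactness of the swapped complex is column exactness. [folklore] -/
theorem rowExact_swap_iff : K.swap.RowExact ↔ K.ColExact :=
  ⟨fun h ↦ ⟨fun p q x hx ↦ h.exact q p x hx⟩, fun h ↦ ⟨fun p q x hx ↦ h.exact q p x hx⟩⟩

variable (R) in
/-- Transposition of families `x ↦ (p q ↦ x q p)`, a linear map between the big modules of `K`
and of `K.swap`. [folklore] -/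
def swapₗ : (∀ p q, X p q) →ₗ[R] (∀ p q, (fun p q ↦ X q p) p q) where
  toFun x p q := x q p
  map_add' _ _ := rfl
  map_smul' _ _ := rfl

/-- Transposition, entrywise. [folklore] -/
@[simp]
theorem swapₗ_apply (x : ∀ p q, X p q) (p q : ℕ) : swapₗ R x p q = x q p :=
  rfl

/-- **Transposition intertwines the total differentials** of `K` and `K.swap`.
[cite: Weibel1994, Lemma 2.7.3 (proof)] -/
theorem swapₗ_totalD (x : ∀ p q, X p q) : swapₗ R (K.totalD x) = K.swap.totalD (swapₗ R x) := by
  funext p q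
  rw [swapₗ_apply, totalD_apply, totalD_apply, add_comm]
  congr 1
  · cases p with
    | zero => rfl
    | succ p => rfl
  · cases q with
    | zero => cases p <;> rfl
    | succ q => cases p <;> rfl

/-- Transposition preserves the total degree. [folklore] -/
theorem swapₗ_mem_Tn {n : ℕ} {x : ∀ p q, X p q} (hx : x ∈ Tn R n) :
    swapₗ R x ∈ Tn R (X := fun p q ↦ X q p) n :=
  fun p q h ↦ hx q p (by omega)

variable (R) in
/-- Transposition on the homogeneous pieces, `Totⁿ K → Totⁿ K.swap`. [folklore] -/
def swapTn (n : ℕ) : ↥(Tn R (X := X) n) →ₗ[R] ↥(Tn R (X := fun p q ↦ X q p) n) :=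
  (swapₗ R).restrict fun _ hx ↦ swapₗ_mem_Tn hx

/-- Underlying family of a transposed homogeneous element. [folklore] -/
@[simp]
theorem coe_swapTn {n : ℕ} (x : ↥(Tn R (X := X) n)) :
    (swapTn R n x : ∀ p q, X q p) = swapₗ R x :=
  rfl

variable (R) in
/-- Transposition on the homogeneous pieces is bijective. [folklore] -/
theorem bijective_swapTn (n : ℕ) : Bijective (swapTn R (X := X) n) := by
  constructor
  · intro x y h
    apply Subtype.ext
    funext p q
    have h' := congrArg (fun z : ↥(Tn R (X := fun p q ↦ X q p) n) ↦ (z : ∀ p q, X q p) q p) h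
    exact h'
  · intro y
    refine ⟨⟨fun p q ↦ (y : ∀ p q, X q p) q p, fun p q h ↦ y.2 q p (by omega)⟩, ?_⟩
    apply Subtype.ext
    funext p q
    rfl

/-- Transposition is a cochain map between the total complexes. [folklore] -/
theorem swapTn_totD (n : ℕ) (x : ↥(Tn R (X := X) n)) :
    swapTn R (n + 1) (K.totD n x) = K.swap.totD n (swapTn R n x) :=
  Subtype.ext (K.swapₗ_totalD x)

/-- **`Hⁿ(Tot K) ≃ Hⁿ(Tot K.swap)`** by transposition. [cite: Weibel1994, Lemma 2.7.3 (proof)] -/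
noncomputable def swapTotEquiv (n : ℕ) :
    NatCochain.Cohomology K.totD n ≃ₗ[R] NatCochain.Cohomology K.swap.totD n :=
  NatCochain.Cohomology.equivOfBijective (swapTn R) K.swapTn_totD (bijective_swapTn R) n

/-- A **column augmentation** of `K` (a complex `B` with maps `η : Bⁿ → X n 0` into the row
`q = 0`, commuting with `δ`, killed by `d`) is a row augmentation of `K.swap`; its exactness
`RowAugmentation.Exact` says that `η` is injective with image `ker d₀`.
[cite: Weibel1994, Thm. 2.7.2 (proof)] -/
abbrev ColAugmentation (B : ℕ → Type w'') [∀ n, AddCommGroup (B n)] [∀ n, Module R (B n)] :=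
  K.swap.RowAugmentation B

variable {K}
variable {B : ℕ → Type w''} [∀ n, AddCommGroup (B n)] [∀ n, Module R (B n)]

/-- **Exact rows and exact columns: the two augmentations have the same cohomology.** For an
anticommuting first-quadrant double complex `K` whose rows are exact (augmented by `A` in the
column `0`) and whose columns are exact (augmented by `B` in the row `0`),
`Hⁿ(A) ≃ₗ[R] Hⁿ(B)` for every `n`: both are `Hⁿ(Tot K)` (Weibel (1994), Lemma 2.7.3 used twice,
as in the proof of Thm. 2.7.2; Bott–Tu (1982), Thm. 8.9 and §12 is the Čech–de Rham case).
[cite: Weibel1994, Lemma 2.7.3] -/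
noncomputable def rowColEquiv (E : K.RowAugmentation A) (E' : K.ColAugmentation B)
    (hK : K.RowExact) (hE : E.Exact) (hK' : K.ColExact) (hE' : E'.Exact) (n : ℕ) :
    NatCochain.Cohomology E.dA n ≃ₗ[R] NatCochain.Cohomology E'.dA n :=
  (E.totEquiv hK hE n).trans
    ((K.swapTotEquiv n).trans (E'.totEquiv (K.rowExact_swap_iff.2 hK') hE' n).symm)

end ADoubleComplex

end Literature.Algebra.Homology
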